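import Literature.Probability.RandomPlanarGeometry.SAWTriangularPolygonInsertion
import Literature.Probability.RandomPlanarGeometry.SAWTriangularLoopRatioFinal
import Literature.Probability.RandomPlanarGeometry.SAWOneStepRateInsertionEngine
import Mathlib.Analysis.SpecialFunctions.Pow.Real
import HarnessLib

/-!
# Kesten's rate for the one-step ratio of self-avoiding polygons of `𝕋`, unconditional («TRI-SAP-RATIO-RATE», R82 — RATE FINAL)

Topic `Literature/Probability/RandomPlanarGeometry` (lane «pcv-sawmu», route R82 «TRI-SAP-RATIO(-RATE)»). Sources:
N. Madras, G. Slade, *The Self-Avoiding Walk* (1993), §7.5 Notes, eqs. (7.5.1)–(7.5.2) p. 255 (Kesten 1963's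
mixed-exponent one-sided rates `-K N^{-1/3} ≤ c_{N+2}(0,x)/c_N(0,x) - μ² ≤ K N^{-1/4}`, printed for the TWO-step
fixed-endpoint ratio on `ℤ^d`; the two-step polygon rate on `ℤ^d` is implicit from (7.5.2) and eq. (3.2.1) p. 63,
never displayed), Theorem 7.3.4 (c) p. 248 (the two-step polygon ratio LIMIT on `ℤ^d`), Remark p. 244 (the one-step
walk limit on `𝕋`), §3.2 (concatenation of polygons, the insertion input). Status in print (lit-2 g12 cell of record,
2026-08-22): for the triangular lattice / one step / non-bipartite case NOTHING is printed — neither the polygon ratio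
limit nor a rate; the exponent pair `(-1/3, +1/4)` is print's `ℤ^d` pair transported, not claimed sharp.

Assembly BY NAME of the four doors of planner a-idea-1 g13's relaxed R82-rate plan (Sketch_G13_R83 §5, glue proved
there; this file ports the glue against the tree): Kesten `triSAPKesten` and `triSAPMonoZ`
(`SAWTriangularLoopRatioFinal.lean`, a-p2), insertion `PolygonInsertion.triSAPInsPoly` (G2ʷ,
`SAWTriangularPolygonInsertion.lean`, a-p2), envelope `abs_log_triLoopCount_sub_le` (`SAWTriangularPolygonGrowth.lean`,
a-p3), fed to a-p1's abstract one-step engine `OneStepRate.oneStepRatioRate_insertion`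
(`SAWOneStepRateInsertionEngine.lean`, text = a-idea-1 g13 §2).

## Contents (namespace `Literature.Probability.RandomPlanarGeometry.SAW`; all PROVED, no hypotheses, axioms standard)

* `LoopRate.polygonRate_of_rawRate` (raw rate ⇒ `q`-normalised rate, correction `O(1/N)`);
* **`triLoopRatioRate`**: `∃ K N₀, ∀ N ≥ N₀, -K N^{-1/3} ≤ t_{N+1}(𝕋)/t_N(𝕋) - μ(𝕋) ≤ K N^{-1/4}`
  (planner face `TriLoopRatioRateMixed`, verbatim);
* **`triSAPRatioRate`**: the same for `q_{N+1}/q_N = N t_{N+1}/((N+1) t_N)` (planner face `TriSAPRatioRateMixed`).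
-/

noncomputable section

open Finset Filter Topology Literature.Probability.LatticeModels Literature.Probability.Percolation SimpleGraph
open scoped BigOperators

namespace Literature.Probability.RandomPlanarGeometry.SAW

namespace LoopRate

/-- The two-sided envelope of `t_n`, exponentiated (supplier; text a-idea-1 g13 §3). [folklore] -/
private theorem envelope_bounds {n : ℕ} (hn : 4 ≤ n) :
    Real.exp (-((53 + 3 * logMuTri) * Real.sqrt n)) * Real.exp logMuTri ^ n ≤ (triLoopCount n : ℝ) ∧
      (triLoopCount n : ℝ) ≤ Real.exp ((53 + 3 * logMuTri) * Real.sqrt n) * Real.exp logMuTri ^ n := by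
  obtain ⟨ht0, hb⟩ := abs_log_triLoopCount_sub_le hn
  obtain ⟨h1, h2⟩ := abs_le.1 hb
  have hμ0 : 0 < Real.exp logMuTri := Real.exp_pos _
  constructor
  · refine (Real.log_le_log_iff (by positivity) ht0).1 ?_
    rw [Real.log_mul (Real.exp_pos _).ne' (pow_pos hμ0 _).ne', Real.log_exp, Real.log_pow, Real.log_exp]
    linarith
  · refine (Real.log_le_log_iff ht0 (by positivity)).1 ?_
    rw [Real.log_mul (Real.exp_pos _).ne' (pow_pos hμ0 _).ne', Real.log_exp, Real.log_pow, Real.log_exp]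
    linarith

/-- The stemmed auxiliary sequence `T_m := μ^k t_{m-k}` keeps the lower envelope (supplier; text a-idea-1 g13 §3).
[folklore] -/
private theorem stem_lower {k m : ℕ} (hm : k + 4 ≤ m) :
    Real.exp (-((53 + 3 * logMuTri) * Real.sqrt m)) * Real.exp logMuTri ^ m ≤
      Real.exp logMuTri ^ k * (triLoopCount (m - k) : ℝ) := by
  have hL := logMuTri_pos.le
  have hμ0 : 0 < Real.exp logMuTri := Real.exp_pos _
  have h1 := (envelope_bounds (n := m - k) (by omega)).1
  have hcast : ((m - k : ℕ) : ℝ) = (m : ℝ) - k := by rw [Nat.cast_sub (by omega)]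
  rw [hcast] at h1
  have hk0 : (0 : ℝ) ≤ k := Nat.cast_nonneg _
  have hsq : Real.sqrt ((m : ℝ) - k) ≤ Real.sqrt m := Real.sqrt_le_sqrt (by linarith)
  have hcc0 : (0 : ℝ) ≤ 53 + 3 * logMuTri := by linarith
  have hexp : Real.exp (-((53 + 3 * logMuTri) * Real.sqrt m)) ≤
      Real.exp (-((53 + 3 * logMuTri) * Real.sqrt ((m : ℝ) - k))) := by
    rw [Real.exp_le_exp]
    have := mul_le_mul_of_nonneg_left hsq hcc0
    linarith
  have hpow : Real.exp logMuTri ^ m = Real.exp logMuTri ^ k * Real.exp logMuTri ^ (m - k) := by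
    rw [← pow_add]; congr 1; omega
  calc Real.exp (-((53 + 3 * logMuTri) * Real.sqrt m)) * Real.exp logMuTri ^ m
      ≤ Real.exp (-((53 + 3 * logMuTri) * Real.sqrt ((m : ℝ) - k))) * Real.exp logMuTri ^ m :=
        mul_le_mul_of_nonneg_right hexp (pow_nonneg hμ0.le _)
    _ = Real.exp logMuTri ^ k *
          (Real.exp (-((53 + 3 * logMuTri) * Real.sqrt ((m : ℝ) - k))) * Real.exp logMuTri ^ (m - k)) := by
        rw [hpow]; ring
    _ ≤ Real.exp logMuTri ^ k * (triLoopCount (m - k) : ℝ) := mul_le_mul_of_nonneg_left h1 (pow_nonneg hμ0.le _)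

/-- The stemmed insertion inequality, cast and re-indexed (supplier; text a-idea-1 g13 §3). [folklore] -/
private theorem stem_ins {Z k n₁ : ℕ}
    (hins : ∀ n m : ℕ, n₁ ≤ n → 3 ≤ m →
      triLoopCount n * triLoopCount m ≤ Z * (n + m + k) ^ 6 * triLoopCount (n + m + k))
    {n m : ℕ} (hn : n₁ ≤ n) (hm : k + 3 ≤ m) :
    (triLoopCount n : ℝ) * (Real.exp logMuTri ^ k * triLoopCount (m - k)) ≤
      Real.exp logMuTri ^ k * max (Z : ℝ) 1 * ((n : ℝ) + m) ^ 6 * triLoopCount (n + m) := by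
  have h0 := hins n (m - k) hn (by omega)
  rw [show n + (m - k) + k = n + m by omega] at h0
  have h1 : (triLoopCount n : ℝ) * triLoopCount (m - k) ≤ Z * ((n : ℝ) + m) ^ 6 * triLoopCount (n + m) := by
    exact_mod_cast h0
  have h2 : (Z : ℝ) * ((n : ℝ) + m) ^ 6 * triLoopCount (n + m) ≤
      max (Z : ℝ) 1 * ((n : ℝ) + m) ^ 6 * triLoopCount (n + m) :=
    mul_le_mul_of_nonneg_right (mul_le_mul_of_nonneg_right (le_max_left _ _) (by positivity)) (Nat.cast_nonneg _)
  have hμk : 0 ≤ Real.exp logMuTri ^ k := pow_nonneg (Real.exp_pos _).le _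
  calc (triLoopCount n : ℝ) * (Real.exp logMuTri ^ k * triLoopCount (m - k))
      = Real.exp logMuTri ^ k * ((triLoopCount n : ℝ) * triLoopCount (m - k)) := by ring
    _ ≤ Real.exp logMuTri ^ k * (max (Z : ℝ) 1 * ((n : ℝ) + m) ^ 6 * triLoopCount (n + m)) :=
        mul_le_mul_of_nonneg_left (h1.trans h2) hμk
    _ = Real.exp logMuTri ^ k * max (Z : ℝ) 1 * ((n : ℝ) + m) ^ 6 * triLoopCount (n + m) := by ring

/-- **Raw rate ⇒ `q`-normalised rate** (`ψ_N = φ_N − φ_N/(N+1)`, correction `O(1/N) ≤ O(N^{-1/3})`); text a-idea-1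
g13 §5.
[cite: MadrasSlade1993, eq. (3.2.1) p. 63 (q_N versus rooted polygons); §7.5 Notes eqs. (7.5.1)–(7.5.2) p. 255] -/
theorem polygonRate_of_rawRate {t : ℕ → ℝ} {μ : ℝ} (hμ : 0 ≤ μ) (hpos : ∀ n : ℕ, 4 ≤ n → 0 < t n)
    (h : ∃ K : ℝ, ∃ N₀ : ℕ, ∀ N : ℕ, N₀ ≤ N →
      -(K * (N : ℝ) ^ (-(1 : ℝ) / 3)) ≤ t (N + 1) / t N - μ ∧ t (N + 1) / t N - μ ≤ K * (N : ℝ) ^ (-(1 : ℝ) / 4)) :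
    ∃ K : ℝ, ∃ N₀ : ℕ, ∀ N : ℕ, N₀ ≤ N →
      -(K * (N : ℝ) ^ (-(1 : ℝ) / 3)) ≤ (N : ℝ) * t (N + 1) / (((N : ℝ) + 1) * t N) - μ ∧
        (N : ℝ) * t (N + 1) / (((N : ℝ) + 1) * t N) - μ ≤ K * (N : ℝ) ^ (-(1 : ℝ) / 4) := by
  obtain ⟨K, N₀, hK⟩ := h
  refine ⟨max K 0 + (μ + max K 0), max N₀ 4, fun N hN => ?_⟩
  have hN4 : 4 ≤ N := le_trans (le_max_right _ _) hN
  have hNr : (4 : ℝ) ≤ N := by exact_mod_cast hN4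
  have hN0 : (0 : ℝ) < N := by linarith
  obtain ⟨h1, h2⟩ := hK N (le_trans (le_max_left _ _) hN)
  have ht0 := hpos N hN4
  have ht1 := hpos (N + 1) (by omega)
  have hψ : (N : ℝ) * t (N + 1) / (((N : ℝ) + 1) * t N) = t (N + 1) / t N - t (N + 1) / t N / (N + 1) := by
    field_simp
    ring
  rw [hψ]
  set φ := t (N + 1) / t N with hφdef
  have hφ0 : 0 ≤ φ := (div_pos ht1 ht0).le
  have hK0 : 0 ≤ max K 0 := le_max_right _ _
  have hKK : K ≤ max K 0 := le_max_left _ _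
  have hr3 : 0 < (N : ℝ) ^ (-(1 : ℝ) / 3) := Real.rpow_pos_of_pos hN0 _
  have hr4 : 0 < (N : ℝ) ^ (-(1 : ℝ) / 4) := Real.rpow_pos_of_pos hN0 _
  have hr4le : (N : ℝ) ^ (-(1 : ℝ) / 4) ≤ 1 := Real.rpow_le_one_of_one_le_of_nonpos (by linarith) (by norm_num)
  have hinv : 1 / ((N : ℝ) + 1) ≤ (N : ℝ) ^ (-(1 : ℝ) / 3) := by
    have h1 : 1 / ((N : ℝ) + 1) ≤ (N : ℝ) ^ (-(1 : ℝ)) := by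
      rw [Real.rpow_neg hN0.le, Real.rpow_one, ← one_div]
      exact one_div_le_one_div_of_le hN0 (by linarith)
    exact h1.trans (Real.rpow_le_rpow_of_exponent_le (by linarith) (by norm_num))
  have a1 : K * (N : ℝ) ^ (-(1 : ℝ) / 4) ≤ max K 0 * (N : ℝ) ^ (-(1 : ℝ) / 4) :=
    mul_le_mul_of_nonneg_right hKK hr4.le
  have a2 : max K 0 * (N : ℝ) ^ (-(1 : ℝ) / 4) ≤ max K 0 := mul_le_of_le_one_right hK0 hr4le
  have a3 : K * (N : ℝ) ^ (-(1 : ℝ) / 3) ≤ max K 0 * (N : ℝ) ^ (-(1 : ℝ) / 3) :=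
    mul_le_mul_of_nonneg_right hKK hr3.le
  have hφup : φ ≤ μ + max K 0 := by linarith
  have hdiv : φ / ((N : ℝ) + 1) ≤ (μ + max K 0) * (N : ℝ) ^ (-(1 : ℝ) / 3) :=
    calc φ / ((N : ℝ) + 1) = φ * (1 / ((N : ℝ) + 1)) := by ring
      _ ≤ (μ + max K 0) * (N : ℝ) ^ (-(1 : ℝ) / 3) := mul_le_mul hφup hinv (by positivity) (by linarith)
  have hdiv0 : 0 ≤ φ / ((N : ℝ) + 1) := by positivity
  constructor
  · nlinarith [hdiv, a3, h1, hr3]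
  · nlinarith [a1, h2, hr4, hK0, hdiv0]

end LoopRate

open LoopRate in
/-- **Kesten's one-step rate for rooted self-avoiding polygons of `𝕋`** (planner face `TriLoopRatioRateMixed`, no
hypotheses): `∃ K N₀, ∀ N ≥ N₀, -K N^{-1/3} ≤ t_{N+1}(𝕋)/t_N(𝕋) - μ(𝕋) ≤ K N^{-1/4}`. Assembly of K82 (`triSAPKesten`),
monotonicity (`triSAPMonoZ`), the G2ʷ insertion (`PolygonInsertion.triSAPInsPoly`) and the R81 envelope
(`abs_log_triLoopCount_sub_le`) through the abstract engine `OneStepRate.oneStepRatioRate_insertion`; glue text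
a-idea-1 g13 §5. [cite: MadrasSlade1993, §7.5 Notes eqs. (7.5.1)–(7.5.2) (p. 255, Kesten 1963's rates);
Theorem 7.3.4(c) (p. 248); Remark p. 244; §3.2] -/
theorem triLoopRatioRate : ∃ K : ℝ, ∃ N₀ : ℕ, ∀ N : ℕ, N₀ ≤ N →
    -(K * (N : ℝ) ^ (-(1 : ℝ) / 3)) ≤ (triLoopCount (N + 1) : ℝ) / triLoopCount N - Real.exp logMuTri ∧
      (triLoopCount (N + 1) : ℝ) / triLoopCount N - Real.exp logMuTri ≤ K * (N : ℝ) ^ (-(1 : ℝ) / 4) := by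
  have hL := logMuTri_pos.le
  have hμ1 : 1 ≤ Real.exp logMuTri := Real.one_le_exp hL
  obtain ⟨D, hK⟩ := triSAPKesten
  obtain ⟨NK, hNK⟩ := eventually_atTop.1 hK
  obtain ⟨A, hA1, N₀, hmono⟩ := triSAPMonoZ
  obtain ⟨Z, k, n₁, hins⟩ := PolygonInsertion.triSAPInsPoly
  set n₀ : ℕ := max (max N₀ NK) (max n₁ 4) + 1 with hn₀def
  have hn₀N₀ : N₀ ≤ n₀ := by omega
  have hn₀NK : NK ≤ n₀ := by omega
  have hn₀n₁ : n₁ ≤ n₀ := by omega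
  have hn₀4 : 4 ≤ n₀ := by omega
  have hn₀1 : 1 ≤ n₀ := by omega
  have hcc0 : (0 : ℝ) ≤ 53 + 3 * logMuTri := by linarith
  have hP1 : 1 ≤ Real.exp logMuTri ^ k * max (Z : ℝ) 1 :=
    one_le_mul_of_one_le_of_one_le (one_le_pow₀ hμ1) (le_max_right _ _)
  have hA1r : (1 : ℝ) ≤ A := by exact_mod_cast hA1
  have e_mono : ∀ n : ℕ, n₀ ≤ n → (triLoopCount n : ℝ) ≤ A * triLoopCount (n + 1) := fun n hn => by
    exact_mod_cast hmono n (le_trans hn₀N₀ hn)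
  have e_K : ∀ n : ℕ, n₀ ≤ n → ((triLoopCount (n + 1) : ℝ) / triLoopCount n) ^ 2 - D / n ≤
      ((triLoopCount (n + 1) : ℝ) / triLoopCount n) * ((triLoopCount (n + 2) : ℝ) / triLoopCount (n + 1)) :=
    fun n hn => hNK n (le_trans hn₀NK hn)
  have e_lo : ∀ n : ℕ, n₀ ≤ n →
      Real.exp (-((53 + 3 * logMuTri) * Real.sqrt n)) * Real.exp logMuTri ^ n ≤ triLoopCount n :=
    fun n hn => (envelope_bounds (le_trans hn₀4 hn)).1
  have e_hi : ∀ n : ℕ, n₀ ≤ n →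
      (triLoopCount n : ℝ) ≤ Real.exp ((53 + 3 * logMuTri) * Real.sqrt n) * Real.exp logMuTri ^ n :=
    fun n hn => (envelope_bounds (le_trans hn₀4 hn)).2
  have e_T : ∀ m : ℕ, k + 4 ≤ m → Real.exp (-((53 + 3 * logMuTri) * Real.sqrt m)) * Real.exp logMuTri ^ m ≤
      Real.exp logMuTri ^ k * (triLoopCount (m - k) : ℝ) := fun m hm => stem_lower hm
  have e_ins : ∀ n m : ℕ, n₀ ≤ n → k + 4 ≤ m →
      (triLoopCount n : ℝ) * (Real.exp logMuTri ^ k * triLoopCount (m - k)) ≤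
        Real.exp logMuTri ^ k * max (Z : ℝ) 1 * ((n : ℝ) + m) ^ 6 * triLoopCount (n + m) :=
    fun n m hn hm => stem_ins hins (le_trans hn₀n₁ hn) (by omega)
  obtain ⟨K, M₀, hKM⟩ := OneStepRate.oneStepRatioRate_insertion (S := fun n => (triLoopCount n : ℝ))
    (T := fun m => Real.exp logMuTri ^ k * (triLoopCount (m - k) : ℝ)) hμ1 hA1r hP1 hcc0 hcc0 hn₀1
    e_mono e_K e_lo e_hi e_ins e_T
  exact ⟨K, M₀, fun N hN => hKM N hN⟩

/-- **Kesten's one-step rate for self-avoiding polygons of `𝕋` counted up to translation** (planner face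
`TriSAPRatioRateMixed`, no hypotheses): with `q_N = t_N/(2N)`,
`∃ K N₀, ∀ N ≥ N₀, -K N^{-1/3} ≤ q_{N+1}(𝕋)/q_N(𝕋) - μ(𝕋) ≤ K N^{-1/4}`.
[cite: MadrasSlade1993, §7.5 Notes eqs. (7.5.1)–(7.5.2) (p. 255, Kesten 1963's rates); Theorem 7.3.4(c) (p. 248);
eq. (3.2.1) (p. 63); Remark p. 244] -/
theorem triSAPRatioRate : ∃ K : ℝ, ∃ N₀ : ℕ, ∀ N : ℕ, N₀ ≤ N →
    -(K * (N : ℝ) ^ (-(1 : ℝ) / 3)) ≤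
        (N : ℝ) * triLoopCount (N + 1) / (((N : ℝ) + 1) * triLoopCount N) - Real.exp logMuTri ∧
      (N : ℝ) * triLoopCount (N + 1) / (((N : ℝ) + 1) * triLoopCount N) - Real.exp logMuTri ≤
        K * (N : ℝ) ^ (-(1 : ℝ) / 4) :=
  LoopRate.polygonRate_of_rawRate (t := fun n => (triLoopCount n : ℝ)) (Real.exp_pos _).le
    (fun _ hn => (abs_log_triLoopCount_sub_le hn).1) triLoopRatioRate

end Literature.Probability.RandomPlanarGeometry.SAW
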